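import Summits.Ventures.PercRepro.GenQFlatLatticeP
import Summits.Ventures.PercRepro.GenQFlatLatticeC

/-!
# PercRepro — the flat-lattice counting rows, part Q: the demand-free credits below the type, and the `k`-subsets of
rank `≥ t` at `t = q − 1` and `t = q` (night-4, gen 12)

Two bridges for the emitter's (GCdf) and (G-E) rows: below the type every `k`-subset has rank `≤ k < t`, so the
credit `gA_k` is the whole spanning-complement count `Σ_m #Pc(k, m)` (`gA_eq_sum_Pc_of_lt`); and the `k`-subsets of
rank `≥ t` are, for `t = q − 1`, the spanning ones plus the rank-`(q − 1)` ones (`card_rank_ge_pred_eq`) and, for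
`t = q`, the spanning ones (`card_rank_ge_self_eq`).  Imports `GenQFlatLatticeP`, `GenQFlatLatticeC`.
-/
namespace PercRepro.Night4

open Finset ThmH SixFour GenQ PerFlat Star

variable {α : Type*} [DecidableEq α] {M : Matroid α} [M.Finite]

/-- Below the type (`k < t`) the demand-free credit is the whole spanning-complement count:
`gA_k = Σ_m #Pc(k, m)`. -/
theorem gA_eq_sum_Pc_of_lt {G : Finset α} {q t k : ℕ} (hG : G ⊆ gr M)
    (hrG : M.eRk (G : Set α) = (q : ℕ∞)) (hk : k < t) :
    gA M G q t k = ∑ m ∈ Finset.Icc (mTr M G) q, (Pc M G q k m).card := by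
  rw [← card_spanning_compl_eq_sum_Pc hG hrG k]
  unfold gA
  congr 1
  refine Finset.filter_congr (fun A hA => ?_)
  rw [Finset.mem_powersetCard] at hA
  constructor
  · exact fun h => h.2
  · intro h
    refine ⟨?_, h⟩
    have h1 : M.eRk (A : Set α) ≤ (A.card : ℕ∞) := by
      have := M.eRk_le_encard (A : Set α)
      rwa [Set.encard_coe_eq_coe_finsetCard] at this
    rw [hA.2] at h1
    calc M.eRk (A : Set α) + 1 ≤ (k : ℕ∞) + 1 := add_le_add_left h1 1
      _ = ((k + 1 : ℕ) : ℕ∞) := by push_cast; rfl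
      _ ≤ (t : ℕ∞) := by exact_mod_cast hk

omit [M.Finite] in
/-- The `k`-subsets of `G` (rank `q`) of rank `≥ q − 1` are the spanning ones and the rank-`(q − 1)` ones
(`1 ≤ q`). -/
theorem card_rank_ge_pred_eq {G : Finset α} {q k : ℕ}
    (hrG : M.eRk (G : Set α) = (q : ℕ∞)) (hq : 1 ≤ q) :
    ((G.powersetCard k).filter (fun A : Finset α => ¬ (M.eRk (A : Set α) + 1 ≤ ((q - 1 : ℕ) : ℕ∞)))).card
      = ((G.powersetCard k).filter (fun A : Finset α => M.eRk (A : Set α) = (q : ℕ∞))).card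
        + ((G.powersetCard k).filter (fun A : Finset α => M.eRk (A : Set α) = ((q - 1 : ℕ) : ℕ∞))).card := by
  classical
  rw [← Finset.card_union_of_disjoint]
  · congr 1
    ext A
    simp only [Finset.mem_filter, Finset.mem_union, Finset.mem_powersetCard]
    constructor
    · rintro ⟨⟨hAG, hAk⟩, hne⟩
      obtain ⟨a, ha⟩ := exists_eRk_eq_nat (M := M) A
      have hle : M.eRk (A : Set α) ≤ (q : ℕ∞) := by
        rw [← hrG]; exact M.eRk_mono (Finset.coe_subset.2 hAG)
      rw [ha] at hle hne ⊢
      have h1 : a ≤ q := by exact_mod_cast hle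
      have h2 : ¬ (a + 1 ≤ q - 1) := by
        intro h; apply hne
        exact_mod_cast h
      rcases Nat.lt_or_ge a q with hlt | hge
      · right; refine ⟨⟨hAG, hAk⟩, ?_⟩
        have : a = q - 1 := by omega
        rw [this]
      · left; refine ⟨⟨hAG, hAk⟩, ?_⟩
        have : a = q := by omega
        rw [this]
    · rintro (⟨⟨hAG, hAk⟩, hr⟩ | ⟨⟨hAG, hAk⟩, hr⟩)
      · refine ⟨⟨hAG, hAk⟩, ?_⟩
        rw [hr]
        intro h
        have h' : q + 1 ≤ q - 1 := by exact_mod_cast h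
        omega
      · refine ⟨⟨hAG, hAk⟩, ?_⟩
        rw [hr]
        intro h
        have h' : q - 1 + 1 ≤ q - 1 := by exact_mod_cast h
        omega
  · rw [Finset.disjoint_left]
    intro A h1 h2
    rw [Finset.mem_filter] at h1 h2
    rw [h1.2] at h2
    have h3 : q = q - 1 := by exact_mod_cast h2.2
    omega

omit [DecidableEq α] [M.Finite] in
/-- The `k`-subsets of `G` (rank `q`) of rank `≥ q` are the spanning ones. -/
theorem card_rank_ge_self_eq {G : Finset α} {q k : ℕ}
    (hrG : M.eRk (G : Set α) = (q : ℕ∞)) :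
    ((G.powersetCard k).filter (fun A : Finset α => ¬ (M.eRk (A : Set α) + 1 ≤ (q : ℕ∞)))).card
      = ((G.powersetCard k).filter (fun A : Finset α => M.eRk (A : Set α) = (q : ℕ∞))).card := by
  classical
  congr 1
  refine Finset.filter_congr (fun A hA => ?_)
  rw [Finset.mem_powersetCard] at hA
  obtain ⟨a, ha⟩ := exists_eRk_eq_nat (M := M) A
  have hle : M.eRk (A : Set α) ≤ (q : ℕ∞) := by
    rw [← hrG]; exact M.eRk_mono (Finset.coe_subset.2 hA.1)
  rw [ha] at hle ⊢
  have h1 : a ≤ q := by exact_mod_cast hle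
  constructor
  · intro hne
    have h2 : ¬ (a + 1 ≤ q) := by
      intro h; apply hne; exact_mod_cast h
    have : a = q := by omega
    rw [this]
  · intro heq
    have : a = q := by exact_mod_cast heq
    rw [this]
    intro h
    have h' : q + 1 ≤ q := by exact_mod_cast h
    omega

end PercRepro.Night4
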